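import Summits.CriticalPhenomena.SAWScalingLimit.Theses.SAWRenewalTightness

/-!
# Sketch — crux `EventualTight` (stmt-CriticalPhenomena-1372), crux-ideate round 1, ideator 2

First-lemma signatures for the two idea cards of this seat:

* `crofton-slab-bridges` — §1: axis SLABS instead of annuli. `Curve.HasSlabTraversals`,
  the deterministic Cauchy–Crofton tortuosity bound `CroftonSlabBound`, the per-slab
  tightness statement `SlabTravTight`, the reduction `SlabTightImpliesEventualTight`, and the
  PROVED lattice fact `isBridge_of_slabTraversal` (a slab traversal of a lattice walk is a
  strict Kesten bridge of span = slab width).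
* `renewal-theorem-bridge-seed` — §2: the Erdős–Feller–Pollard renewal theorem in the SPAN
  variable of Kesten's identity. `bridgeSpanMass` (`u_L`), `irrSpanMass` (`p_ℓ`), `meanSpan`
  (`m`), and the typed claims `SpanOneMass`, `RenewalLimit`, `SpanSeedBound`,
  `BridgeDecayIffInfiniteMeanSpan`.

* `shadowing-hyperspace` — §3: `HasShadowingPair`, the deterministic `ShadowingPigeonhole`,
  `NoShadowing`, `NoShadowingImpliesEventualTight`.

Everything is stated over existing declarations; nothing here is a route item.
-/

noncomputable section

open MeasureTheory Filter Topology Set Metric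
open scoped ENNReal NNReal BigOperators unitInterval
open Literature.Probability.RandomPlanarGeometry
open Literature.Probability.LatticeModels

namespace Summit.CriticalPhenomena.SAWScalingLimit.Cruxes.EventualTight.Ideator2

/-! ## §1  Slabs instead of annuli -/

/-- The `e`-th real coordinate of a complex number (`e = 0`: real part, `e = 1`: imaginary
part). -/
def coord (e : Fin 2) (z : ℂ) : ℝ := if e = 0 then z.re else z.im

/-- The segment `γ|[s,t]` **traverses the open slab** `{c < coord e < c + w}`: one endpoint lies
weakly on one side, the other weakly on the other side (either order).  This is the slab
analogue of `Curve.IsTraversal` (AB99 §1.b). -/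
def IsSlabTraversal (γ : Curve ℂ) (e : Fin 2) (c w : ℝ) (s t : I) : Prop :=
  s ≤ t ∧ ((coord e (γ s) ≤ c ∧ c + w ≤ coord e (γ t)) ∨
           (c + w ≤ coord e (γ s) ∧ coord e (γ t) ≤ c))

/-- **`k` separate slab traversals**: `k` segments on pairwise disjoint parameter intervals,
listed in increasing order, each traversing the slab (cf. `Curve.HasTraversals`). -/
def HasSlabTraversals (γ : Curve ℂ) (k : ℕ) (e : Fin 2) (c w : ℝ) : Prop :=
  ∃ s t : Fin k → I, (∀ i, IsSlabTraversal γ e c w (s i) (t i)) ∧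
    ∀ ⦃i j : Fin k⦄, i < j → t i < s j

/-- **Cauchy–Crofton tortuosity bound (deterministic; FIRST LEMMA of card
`crofton-slab-bridges`, provable now).**  For a curve inside the closed ball `B̄(0, L)` and a
grid spacing `s > 0`: if for every axis direction `e` and every grid slab
`{j s < coord e < (j+1) s}` the curve makes fewer than `n e j` separate traversals, then its
tortuosity at scale `6 s` is at most `∑_{e, |j| ≤ ⌈L/s⌉+1} n e j`.
Proof plan: the greedy division with stopping distance `a = 2√2·s` (AB99 §2.b,
`Curve.stopSeq`) has pieces of diameter `≤ 2a ≤ 6 s`; each stopping increment moves one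
coordinate by `≥ a/√2 = 2 s`, hence contains a full traversal of some grid slab of that
coordinate, on its own parameter interval; so the number of increments is at most the total
number of slab traversals available, which is `< ∑ n e j` by hypothesis (pigeonhole over the
finitely many slabs meeting `B̄(0,L)`). Compare the annular version
`Curve.tortuosity_le_of_cover` (AB99 (2.22), in tree). -/
def CroftonSlabBound : Prop :=
  ∀ (γ : Curve ℂ) (L s : ℝ), 0 < s → γ.range ⊆ closedBall (0 : ℂ) L →
    ∀ n : Fin 2 → ℤ → ℕ, (∀ (e : Fin 2) (j : ℤ), ¬ HasSlabTraversals γ (n e j) e (j * s) s) →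
      γ.tortuosity (6 * s) ≤ ∑ e : Fin 2, ∑ j ∈ Finset.Icc (-(⌈L / s⌉ + 1)) (⌈L / s⌉ + 1), n e j

/-- **Per-slab traversal tightness** of the critical `δℤ²` SAW laws: for every Dobrushin
domain and endpoint approximation there is `δ₀ > 0` such that for every axis slab of positive
width and every `ε > 0` some number `k` of separate traversals of that slab has probability
`≤ ε` for ALL `δ ∈ (0, δ₀]`.  (No rate in `k`, no relation between slabs, no exponent; `k` may
depend on the slab — boundary fjords can force finitely many traversals per slab.) -/
def SlabTravTight : Prop :=
  ∀ (D : DobrushinDomain) (a b : ℝ → Site 2), SAW.IsEndpointApprox D a b →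
    ∃ δ₀ : ℝ, 0 < δ₀ ∧ ∀ (e : Fin 2) (c w : ℝ), 0 < w → ∀ ε : ℝ, 0 < ε → ∃ k : ℕ,
      ∀ δ ∈ Ioc (0 : ℝ) δ₀,
        SAW.law D.carrier δ (a δ) (b δ)
          {γ | HasSlabTraversals (⟨γ.walk.toCurve (meshPoint δ)⟩ : Curve ℂ) k e c w}
          ≤ ENNReal.ofReal ε

/-- **The reduction (provable now, M–L): per-slab tightness ⇒ the crux.**
Plan: the SAW polylines of `Ω_δ` lie in a fixed compact ball (confinement, cf. HexTight
Disproof §2b / `z2_window_compact`); by `CroftonSlabBound` with `s = ε/6` and the finitely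
many (`≤ 2(2⌈L/s⌉+3)`) slabs, `P_δ[tortuosity (ε) > N]` is bounded by a finite sum of per-slab
traversal probabilities, each `≤ θ/(#slabs)` for `k` large by `SlabTravTight`; then AB99
Lemma 4.1 (`CurveClass.isCompact_closure_image_mk_of_tortuosity_le`, PROVED in tree) gives a
compact carrying `1 − θ` of every law, `δ ≤ δ₀` — i.e. `IsTightMeasureSet` on `Ioc 0 δ₀`. The
converse (crux ⇒ `SlabTravTight`) is the slab analogue of the landed
`ShellCrossingBound.Negative.bound_of_isTightMeasureSet`. -/
def SlabTightImpliesEventualTight : Prop :=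
  SlabTravTight → Summit.CriticalPhenomena.SAWScalingLimit.Theses.SAWRenewalTightness.EventualTight

/-- **A slab traversal of a lattice walk IS a strict Kesten bridge (PROVED).**  If a lattice
walk `ω` (vertex function on `ℤ²`) is at first coordinate `i₁` at time `σ`, at `i₂ ≥ i₁` at time
`τ > σ`, and strictly between at all intermediate times, then the re-based segment
`t ↦ ω (σ + t) − ω σ`, `0 ≤ t ≤ τ − σ`, satisfies `SAW.Zd.IsBridge` (Madras–Slade Def. 1.2.4:
`ω₁(0) < ω₁(t) ≤ ω₁(n)`), with span `i₂ − i₁`.  With lattice steps of size one, the first vertex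
of a slab traversal after its last visit of the entry line is exactly on that line, so every
separate traversal of an axis slab of lattice width `W` by the SAW polyline yields a disjoint
strict bridge of span `W` — the object of Kesten's renewal theory (route support items
`KestenIdentity`, `StripMassConservation`). -/
theorem isBridge_of_slabTraversal (ω : ℕ → Site 2) (i0 j0 : ℕ) (i₁ i₂ : ℤ) (hi0j0 : i0 < j0)
    (hlt : i₁ < i₂) (hi0 : ω i0 0 = i₁) (hj0 : ω j0 0 = i₂)
    (hmid : ∀ t, i0 < t → t < j0 → i₁ < ω t 0 ∧ ω t 0 < i₂) :
    SAW.Zd.IsBridge (j0 - i0) (fun t => ω (i0 + t) - ω i0) := by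
  intro i h1 hi
  have hend : i0 + (j0 - i0) = j0 := by omega
  simp only [Pi.sub_apply, add_zero, hend, hi0, hj0]
  rcases Nat.lt_or_ge (i0 + i) j0 with h | h
  · obtain ⟨ha, hb⟩ := hmid (i0 + i) (by omega) h
    constructor <;> omega
  · have hi' : i0 + i = j0 := by omega
    rw [hi', hj0]
    constructor <;> omega

/-! ## §2  The renewal theorem in the span variable of Kesten's identity -/

/-- `u_L`: the `x_c`-mass of bridges of span `L` from the origin (all lengths), the span-`L`
bridge generating function at criticality (`B_{x_c}(L)` of Madras–Slade §4.2; `B_T(x_c)` of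
DCS12/KP23 on the hexagonal lattice).  The route's support item `StripMassConservation`
(stmt-4734) says every partial sum is `≤ 1`, so the series converges and `u_L ≤ 1`
(Kesten). -/
def bridgeSpanMass (L : ℤ) : ℝ :=
  ∑' n : ℕ, ∑ _ω ∈ (SAW.Zd.bridges 2 n).filter (fun ω => ω n 0 = L), SAW.criticalFugacity ^ n

/-- `p_ℓ`: the `x_c`-mass of IRREDUCIBLE bridges of span `ℓ` (word model of
`SAWWordBridges.lean`, span = `SAW.xEnd`).  By Kesten's identity (route support item
`KestenIdentity`, stmt-4733: `Σ_irr x_c^{|β|} = 1`) the `p_ℓ` form a probability distribution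
on `ℕ≥1` — the inter-arrival law of the SPAN renewal process. -/
def irrSpanMass (ℓ : ℕ) : ℝ :=
  ∑' w : {w : List SAW.Step // SAW.IsIrrBridge w ∧ SAW.xEnd w = ℓ},
    SAW.criticalFugacity ^ w.1.length

/-- `m = Σ ℓ p_ℓ ∈ [1, ∞]`: the mean span of Kesten's irreducible bridge (possibly `⊤`). -/
def meanSpan : ℝ≥0∞ := ∑' ℓ : ℕ, (ℓ : ℝ≥0∞) * ENNReal.ofReal (irrSpanMass ℓ)

/-- **Span-one irreducible mass (provable now, S).**  Every bridge of span `1` is irreducible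
(spans of bridges are `≥ 1`, so no proper concatenation has span `1`), and the span-`1` bridges
from the origin are exactly `e₁` followed by a vertical run of any length in either direction:
`p₁ = x_c (1 + 2 Σ_{k≥1} x_c^k) = x_c (1 + x_c)/(1 − x_c) ≈ 0.842`. -/
def SpanOneMass : Prop :=
  irrSpanMass 1 = SAW.criticalFugacity * (1 + SAW.criticalFugacity) / (1 - SAW.criticalFugacity)

/-- **The renewal theorem in the span variable (FIRST LEMMA of card
`renewal-theorem-bridge-seed`; provable now, M).**  Unique factorisation of bridges into
irreducible bridges (MS93 §4.2; tree: `SAW.eq_of_append_eq`) gives the discrete renewal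
equation `u_L = Σ_{ℓ=1}^{L} p_ℓ u_{L−ℓ}`, `u_0 = 1`; Kesten's identity gives `Σ p_ℓ = 1`;
`p₁ > 0` gives aperiodicity; hence by Erdős–Feller–Pollard (MS93 Thm 4.2.2(b), proved there in
App. B) `u_L → 1/m` with `1/∞ = 0`. -/
def RenewalLimit : Prop :=
  Tendsto (fun L : ℕ => bridgeSpanMass L) atTop (𝓝 (meanSpan⁻¹).toReal)

/-- **A proved seed below Kesten's bound (corollary, provable now).**  Since `p₁ < 1` and
every other irreducible bridge has span `≥ 2`, `m ≥ p₁ + 2 (1 − p₁) = 2 − p₁`, so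
`limsup_L u_L ≤ 1/(2 − p₁) = (1 − x_c)/(2 − 3 x_c − x_c²) ≈ 0.863`: for every larger `η`,
`u_L ≤ η` for all large spans `L`.  (Kesten: `u_L ≤ 1` for all `L`; `u_L → 0` is the open
bridge-decay problem on `ℤ²`.) -/
def SpanSeedBound : Prop :=
  ∀ η : ℝ, (1 - SAW.criticalFugacity) / (2 - 3 * SAW.criticalFugacity - SAW.criticalFugacity ^ 2)
    < η → ∀ᶠ L : ℕ in atTop, bridgeSpanMass L ≤ η

/-- **Bridge decay on `ℤ²` is a one-moment statement (provable now from `RenewalLimit`).**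
`u_L → 0` (the open problem: DCS12/GM20 prove it on the hexagonal lattice via the parafermion;
KP23 p.2 "a major obstacle" on `ℤ²`) holds iff Kesten's irreducible bridge has INFINITE mean
span. -/
def BridgeDecayIffInfiniteMeanSpan : Prop :=
  Tendsto (fun L : ℕ => bridgeSpanMass L) atTop (𝓝 0) ↔ meanSpan = ⊤

/-- **Certified lowering of the seed (finite computations).**  For every truncation `ℓ₀`,
`m ≥ Σ_{ℓ≤ℓ₀} ℓ p_ℓ + (ℓ₀+1)(1 − Σ_{ℓ≤ℓ₀} p_ℓ)`; irreducible bridges of span `ℓ` live in the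
vertical strip of width `ℓ+1`, so each `p_ℓ` is the value at `x_c` of a strip generating
function (rational, strip transfer matrices `SAWStripTM*.lean` in tree), enclosed by
monotonicity in `x` over the certified `x_c`-interval.  Typed as: any certified lower bound
`M ≤ m` yields the eventual seed `1/M`. -/
def SeedOfMeanSpanBound : Prop :=
  ∀ M : ℝ≥0∞, M ≤ meanSpan → ∀ η : ℝ, (M⁻¹).toReal < η → ∀ᶠ L : ℕ in atTop, bridgeSpanMass L ≤ η

/-! ## §3  Hyperspace pigeonhole: unbounded oscillation forces mutual shadowing -/

/-- **A mutually shadowing pair of traversal strands**: two segments of `γ` on disjoint,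
ordered parameter intervals, each a traversal of the shell `D(x; r, R)` (`Curve.IsTraversal`),
whose images are within Hausdorff distance `η` of each other. -/
def HasShadowingPair (γ : Curve ℂ) (x : ℂ) (r R η : ℝ) : Prop :=
  ∃ s₁ t₁ s₂ t₂ : I, γ.IsTraversal x r R s₁ t₁ ∧ γ.IsTraversal x r R s₂ t₂ ∧ t₁ < s₂ ∧
    (∀ u : I, s₁ ≤ u → u ≤ t₁ → ∃ v : I, s₂ ≤ v ∧ v ≤ t₂ ∧ dist (γ u) (γ v) ≤ η) ∧
    (∀ v : I, s₂ ≤ v → v ≤ t₂ → ∃ u : I, s₁ ≤ u ∧ u ≤ t₁ ∧ dist (γ u) (γ v) ≤ η)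

/-- **Hyperspace pigeonhole (deterministic; FIRST LEMMA of card `shadowing-hyperspace`,
provable now, M).**  In a compact region, a curve with `k` separate traversals of a genuine shell,
`k` large depending only on `(Λ, x, r, R, η)`, has two traversal strands within Hausdorff distance
`η` of each other.  Proof plan: the images of the `k` strands are compact subsets of the compact
closed shell `Λ ∩ D̄(x; r, R)`; the hyperspace of nonempty compact subsets with the Hausdorff
metric is compact (Mathlib: `EMetric.NonemptyCompacts.compactSpace` / totally bounded), so it is
covered by finitely many `η/2`-balls, `N(η)` of them; `k > N(η)` puts two strands in one ball. -/
def ShadowingPigeonhole : Prop :=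
  ∀ (Λ : Set ℂ), IsCompact Λ → ∀ (x : ℂ) (r R η : ℝ), r < R → 0 < η →
    ∃ k : ℕ, ∀ γ : Curve ℂ, γ.range ⊆ Λ → γ.HasTraversals k x r R → HasShadowingPair γ x r R η

/-- `ShadowingPigeonhole` holds (PROVED; elementary — no hyperspace needed: code each strand by the
set of points of a finite `η/2`-net of `Λ` that it approaches within `η/2`; equal codes ⇒ mutual
`η`-shadowing; pigeonhole over the `2^{|net|}` codes). -/
theorem shadowingPigeonhole_holds : ShadowingPigeonhole := by
  intro Λ hΛ x r R η _hrR hη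
  obtain ⟨T, -, hTfin, hTcov⟩ := finite_cover_balls_of_compact hΛ (half_pos hη)
  classical
  refine ⟨hTfin.toFinset.powerset.card + 1, fun γ hγΛ hk => ?_⟩
  obtain ⟨s, t, hst, hsep⟩ := hk
  let code : Fin (hTfin.toFinset.powerset.card + 1) → Finset ℂ := fun i =>
    hTfin.toFinset.filter (fun p => ∃ u : I, s i ≤ u ∧ u ≤ t i ∧ dist (γ u) p < η / 2)
  have hmaps : ∀ i ∈ (Finset.univ : Finset (Fin (hTfin.toFinset.powerset.card + 1))),
      code i ∈ hTfin.toFinset.powerset := by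
    intro i _
    exact Finset.mem_powerset.2 (Finset.filter_subset _ _)
  have hcard : hTfin.toFinset.powerset.card <
      (Finset.univ : Finset (Fin (hTfin.toFinset.powerset.card + 1))).card := by
    simp
  obtain ⟨i, -, j, -, hij, hcode⟩ := Finset.exists_ne_map_eq_of_card_lt_of_maps_to hcard hmaps
  have close : ∀ {i j : Fin (hTfin.toFinset.powerset.card + 1)}, code i = code j →
      ∀ u : I, s i ≤ u → u ≤ t i →
      ∃ v : I, s j ≤ v ∧ v ≤ t j ∧ dist (γ u) (γ v) ≤ η := by
    intro i j h u hsu hut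
    have hmem : γ u ∈ Λ := hγΛ ⟨u, rfl⟩
    obtain ⟨p, hpT, hpu⟩ := Set.mem_iUnion₂.1 (hTcov hmem)
    have h1 : dist (γ u) p < η / 2 := by simpa [Metric.mem_ball] using hpu
    have hp : p ∈ code i :=
      Finset.mem_filter.2 ⟨hTfin.mem_toFinset.2 hpT, u, hsu, hut, h1⟩
    rw [h] at hp
    obtain ⟨-, v, hsv, hvt, hv⟩ := Finset.mem_filter.1 hp
    refine ⟨v, hsv, hvt, ?_⟩
    calc dist (γ u) (γ v) ≤ dist (γ u) p + dist (γ v) p := dist_triangle_right _ _ _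
      _ ≤ η := by linarith
  rcases lt_or_gt_of_ne hij with hlt | hlt
  · refine ⟨s i, t i, s j, t j, hst i, hst j, hsep hlt, close hcode, fun v hsv hvt => ?_⟩
    obtain ⟨u, hsu, hut, hd⟩ := close hcode.symm v hsv hvt
    exact ⟨u, hsu, hut, by rwa [dist_comm] at hd⟩
  · refine ⟨s j, t j, s i, t i, hst j, hst i, hsep hlt, close hcode.symm, fun v hsv hvt => ?_⟩
    obtain ⟨u, hsu, hut, hd⟩ := close hcode v hsv hvt
    exact ⟨u, hsu, hut, by rwa [dist_comm] at hd⟩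

/-- **No asymptotic mutual shadowing** of the critical `δℤ²` SAW: for every fixed genuine shell
and every `θ > 0` there is a resolution `η > 0` below which two mutually `η`-shadowing traversal
strands have probability `≤ θ`, uniformly in `δ ≤ δ₀(D,a,b)`.  (True value for SLE-like curves:
`exp(−c (R/η)^{4/3})`-small — the widest target any tightness argument can aim at.) -/
def NoShadowing : Prop :=
  ∀ (D : DobrushinDomain) (a b : ℝ → Site 2), SAW.IsEndpointApprox D a b →
    ∃ δ₀ : ℝ, 0 < δ₀ ∧ ∀ (x : ℂ) (r R : ℝ), 0 < r → r < R → ∀ θ : ℝ, 0 < θ → ∃ η : ℝ, 0 < η ∧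
      ∀ δ ∈ Ioc (0 : ℝ) δ₀,
        SAW.law D.carrier δ (a δ) (b δ)
          {γ | HasShadowingPair (⟨γ.walk.toCurve (meshPoint δ)⟩ : Curve ℂ) x r R η}
          ≤ ENNReal.ofReal θ

/-- **The reduction (provable now, M–L): no shadowing ⇒ the crux.**  Per-shell tightness
suffices for the crux (AB99 (2.22) `Curve.tortuosity_le_of_cover` + Lemma 4.1, both in tree; the
sibling card `markov-fibration-pocket`'s `ChainA₂`); and by `ShadowingPigeonhole`,
`P_δ[k traversals of D(x;r,R)] ≤ P_δ[shadowing pair at resolution η(k)]` with `η(k) → 0`, so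
`NoShadowing` gives per-shell tightness. -/
def NoShadowingImpliesEventualTight : Prop :=
  NoShadowing → Summit.CriticalPhenomena.SAWScalingLimit.Theses.SAWRenewalTightness.EventualTight

end Summit.CriticalPhenomena.SAWScalingLimit.Cruxes.EventualTight.Ideator2
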